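/-
COR-CM (cell pub-hodgecm2, stage 2 of the Hodge ladder) — Δ2 BRIDGE, J-column junction J2 ⇄ J3, CLOSED: the hypothesis `hN` of
`CorCM/D2Bridge/AlbaneseOnPieceJointlyZero.lean` («the `Y_c × Y_c` jointly cover `(∇X)_ℂ`») DISCHARGED from
`Liu2021/NablaBaseChangeCover.lean`, and the resulting UNCONDITIONAL detection of homomorphisms `Alb_X → B` over `k` on the
pieces' Jacobians / Abel–Jacobi pull-backs — the `hfaith` leg of the pin's `Map43RationalData.P_injective` in the J2 currency.
Seat prover-pub-hodgecm2-d2bridge-prove-3-g0-0 (d2bridge-prove-3).  THEOREMS ONLY; no `sorry`; hole-free imports (no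
`HodgeCM.Model.*`, no manifest path).  HC_CM is NOT proved; nothing here is a display or a pointer move.
-/
import Summits.HodgeConjecture.CorCM.D2Bridge.AlbaneseOnPieceJointlyZero
import Literature.NumberTheory.Automorphic.Liu2021.NablaBaseChangeCover
import Literature.NumberTheory.Automorphic.Liu2021.NablaOfPieces
import HarnessLib

/-!
# Δ2 bridge, J2 ⇄ J3: a non-zero `φ : Alb_X → B` over `k` is seen by some piece's Abel–Jacobi pull-back — unconditionally

Setting of `AlbaneseOnPieceCore` at a smooth projective `X / k` (`k` of characteristic zero, `[Algebra k ℂ]`), ANY Albanese datum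
`a : Albanese X` ([Liu2021] Def. 2.3), ANY colimit cofan `inj c : Y_c ⟶ X ⊗_k ℂ` of geometrically irreducible complex varieties,
Jacobian data `𝒥 c` and base points `P c`:

* `isOpenImmersion_left_nablaLiftPiece`, `nablaLiftPiece_jointlyEpi` — the lifts `Y_c × Y_c ⟶ (∇X)_ℂ` are JOINTLY EPIMORPHIC: every point of `(∇X)_ℂ` lies in some
  `Y_c × Y_c` (`Nabla.exists_mem_range_tensorHom_baseChange_complex`), the lifts are open immersions, and morphisms of schemes
  agreeing on an open cover agree (Mathlib `Scheme.hom_ext_of_forall`).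
* `eq_zero_of_albDesc_comp_baseChange_eq_zero_of_isColimit'` — `(∀ c, albDesc_c ≫ φ_ℂ = 0) → φ = 0`, NO hypothesis `hN`.
* `exists_albDesc_comp_baseChange_ne_zero'`, `exists_pull_abelJacobi_albDesc_baseChange_ne_zero'`,
  `exists_pull_albOnPiece_baseChange_ne_zero'` — the `hfaith` shapes, unconditionally: a non-zero `φ : Alb_X → B` over `k` has a
  piece with `(albOnPiece a (inj c) (P c) ≫ φ_ℂ)^* ≠ 0` on `H¹(B(ℂ); ℚ)` whenever the `(f^{P_c})^*` are injective on `H¹`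
  ([Liu2021] Lemma 2.4 (1) at the pieces; at the pin `Model.isIso_bettiCohomology_map_abelJacobi_pms`).

[Liu2021] proof of Thm. 4.18 (l. 2248–2250): «by pulling back … we obtain an injective map»; the injectivity is faithfulness of the
rational representation composed with Lemma 2.4 (1), here made explicit on Liu's `Alb_{X_K}` for an arbitrary Albanese datum.
HC_CM is NOT proved.

## References
* [Liu2021] Y. Liu, *Fourier–Jacobi cycles and arithmetic relative trace formula*, Camb. J. Math. 9 (2021) = arXiv:2102.11518:
  §2.1 Def. 2.1 (1), Def. 2.3 with the Proposition (FJcycle.tex l. 1171–1208), Lemma 2.4 (1) (l. 1211–1228); proof of Thm. 4.18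
  (l. 2248–2250).
* [GortzWedhorn2020] U. Görtz, T. Wedhorn, *Algebraic Geometry I*, 2nd ed., §(3.5) Example 3.11, Theorem 14.72 (1).
-/

set_option autoImplicit false

noncomputable section

open CategoryTheory CategoryTheory.Limits AlgebraicGeometry MonoidalCategory CartesianMonoidalCategory
open Function
open Literature.AlgebraicGeometry.Motives
open Literature.AlgebraicGeometry.HodgeTheory
open Literature.NumberTheory.Automorphic.Liu2021.AppendixC
open scoped MonObj

namespace Summit.HodgeConjecture.CorCM.D2Bridge

open AbelianVariety (bcSpec bcFunctor)

set_option backward.isDefEq.respectTransparency false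

variable {k : Type} [Field k] [CharZero k] [Algebra k ℂ] {d : ℕ} {X : SchemeOver k} [SmoothOfRelativeDimension d X.hom]
  (hX : IsProjectiveOver X) (a : Albanese X)
  {κ : Type} {Y : κ → SchemeOver ℂ} (inj : ∀ c, Y c ⟶ (bcFunctor k ℂ).obj X)
  [∀ c, GeometricallyIrreducible (Y c).hom] (hcol : IsColimit (Cofan.mk ((bcFunctor k ℂ).obj X) inj))

/-! ## The lifts `Y_c × Y_c ⟶ (∇X)_ℂ` are open immersions and jointly epimorphic -/

omit [CharZero k] [SmoothOfRelativeDimension d X.hom] in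
include hcol in
/-- The lift `Y_c × Y_c ⟶ (∇X)_ℂ` of a cofan leg is an open immersion (`inj_c × inj_c` is one, Görtz–Wedhorn I Example 3.11 with
Mathlib `MorphismProperty.pullbackMap`; `μ` is an isomorphism; cancel the open immersion `(∇X)_ℂ ↪ (X × X)_ℂ`,
Mathlib `IsOpenImmersion.of_comp`). [cite: GortzWedhorn2020, §(3.5) Example 3.11] -/
theorem isOpenImmersion_left_nablaLiftPiece (c : κ) : IsOpenImmersion (nablaLiftPiece a (inj c)).left := by
  haveI : ∀ c, IsOpenImmersion (inj c).left := fun c => isOpenImmersion_left_of_isColimit hcol c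
  haveI := a.nabla.isOpenImmersion_incl
  haveI : IsOpenImmersion ((bcFunctor k ℂ).map a.nabla.incl).left :=
    GaloisDescent.isOpenImmersion_bcFunctor_map_left ℂ a.nabla.incl
  haveI : IsIso (Functor.LaxMonoidal.μ (bcFunctor k ℂ) X X).left :=
    ((Over.forget _).mapIso (Functor.Monoidal.μIso (bcFunctor k ℂ) X X)).isIso_hom
  have h1 : IsOpenImmersion (inj c ⊗ₘ inj c).left := by
    rw [Over.tensorHom_left]
    exact MorphismProperty.pullbackMap (P := @IsOpenImmersion) (isOpenImmersion_left_of_isColimit hcol c)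
      (isOpenImmersion_left_of_isColimit hcol c) (Over.w (inj c)).symm (Over.w (inj c)).symm
  have h2 : IsOpenImmersion ((nablaLiftPiece a (inj c)).left ≫ ((bcFunctor k ℂ).map a.nabla.incl).left) := by
    rw [← Over.comp_left, nablaLiftPiece_incl, Over.comp_left]
    infer_instance
  exact IsOpenImmersion.of_comp _ ((bcFunctor k ℂ).map a.nabla.incl).left

omit [CharZero k] [SmoothOfRelativeDimension d X.hom] in
/-- A point of `(∇X)_ℂ` whose image in `(X × X)_ℂ` lies in `inj_c × inj_c (Y_c × Y_c)` lies in the image of the lift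
`Y_c × Y_c ⟶ (∇X)_ℂ` (the inclusion `(∇X)_ℂ ↪ (X × X)_ℂ` is injective). [cite: Liu2021, §2.1 Def. 2.1 (1) (FJcycle.tex l. 1171–1174)] -/
theorem mem_range_nablaLiftPiece_of_mem (c : κ) (m : ↥((bcFunctor k ℂ).obj a.nabla.N).left)
    (hm : ((bcFunctor k ℂ).map a.nabla.incl).left m ∈
      Set.range ⇑((inj c ⊗ₘ inj c) ≫ Functor.LaxMonoidal.μ (bcFunctor k ℂ) X X).left) :
    m ∈ Set.range ⇑(nablaLiftPiece a (inj c)).left := by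
  haveI := a.nabla.isOpenImmersion_incl
  haveI : IsOpenImmersion ((bcFunctor k ℂ).map a.nabla.incl).left :=
    GaloisDescent.isOpenImmersion_bcFunctor_map_left ℂ a.nabla.incl
  obtain ⟨y, hy⟩ := hm
  refine ⟨y, (Scheme.Hom.isOpenEmbedding ((bcFunctor k ℂ).map a.nabla.incl).left).injective ?_⟩
  rw [← Scheme.Hom.comp_apply, ← Over.comp_left, nablaLiftPiece_incl]
  exact hy

include d hX hcol in
/-- **The lifts `Y_c × Y_c ⟶ (∇X)_ℂ` are jointly epimorphic** («`(∇X)_ℂ = ⋃_c Y_c × Y_c`»): two morphisms out of `(∇X)_ℂ` over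
`Spec ℂ` that agree on every `Y_c × Y_c` are equal — every point of `(∇X)_ℂ` lies in some `Y_c × Y_c`
(`Nabla.exists_mem_range_tensorHom_baseChange_complex`), the lifts are open immersions, and morphisms of schemes agreeing on an
open cover agree (Mathlib `Scheme.hom_ext_of_forall`).  This is the hypothesis `hN` of `eq_zero_of_albDesc_comp_baseChange_eq_zero`.
[cite: Liu2021, §2.1 proof of the Proposition (FJcycle.tex l. 1194–1200) and proof of Lemma 2.4 (1) (l. 1220–1228)] -/
theorem nablaLiftPiece_jointlyEpi {Z : SchemeOver ℂ} (f g : (bcFunctor k ℂ).obj a.nabla.N ⟶ Z)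
    (h : ∀ c, nablaLiftPiece a (inj c) ≫ f = nablaLiftPiece a (inj c) ≫ g) : f = g := by
  haveI : ∀ c, IsOpenImmersion (nablaLiftPiece a (inj c)).left := fun c =>
    isOpenImmersion_left_nablaLiftPiece a inj hcol c
  apply Over.OverMorphism.ext
  apply Scheme.hom_ext_of_forall
  intro m
  obtain ⟨c, hc⟩ := Nabla.exists_mem_range_tensorHom_baseChange_complex (d := d) hX a.nabla inj hcol m
  obtain ⟨y, hy⟩ := mem_range_nablaLiftPiece_of_mem a inj c m hc
  refine ⟨(nablaLiftPiece a (inj c)).left.opensRange, ⟨y, hy⟩, ?_⟩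
  have hc' := congrArg (fun ψ => (nablaLiftPiece a (inj c)).left.isoOpensRange.inv ≫ ψ.left) (h c)
  simpa only [Over.comp_left, ← Category.assoc, Scheme.Hom.isoOpensRange_inv_comp] using hc'

/-! ## Unconditional detection -/

include d hX hcol in
/-- **Homomorphisms `φ : Alb_X → B` over `k` are detected, after complexification, on the pieces' Jacobians** — unconditionally:
`(∀ c, albDesc_c ≫ φ_ℂ = 0) → φ = 0` (`eq_zero_of_albDesc_comp_baseChange_eq_zero` with `hN := nablaLiftPiece_jointlyEpi`).
[cite: Liu2021, Def. 2.3 with the Proposition (FJcycle.tex l. 1190–1208) and proof of Lemma 2.4 (1) (l. 1220–1228)] -/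
theorem eq_zero_of_albDesc_comp_baseChange_eq_zero' (𝒥 : ∀ c, Jacobian (Y c)) {B : AbelianVariety k} (φ : a.Alb ⟶ B)
    (h : ∀ c, albDesc a (inj c) (𝒥 c) ≫ AbelianVariety.Hom.baseChange ℂ φ = 0) : φ = 0 :=
  eq_zero_of_albDesc_comp_baseChange_eq_zero a inj 𝒥
    (fun f g hfg => nablaLiftPiece_jointlyEpi (d := d) hX a inj hcol f g hfg) φ h

include d hX hcol in
/-- **A non-zero `φ : Alb_X → B` over `k` is non-zero on some piece's Jacobian after complexification** — unconditionally.
[cite: Liu2021, proof of Thm. 4.18 (FJcycle.tex l. 2248–2250) with proof of Lemma 2.4 (1) (l. 1220–1228)] -/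
theorem exists_albDesc_comp_baseChange_ne_zero' (𝒥 : ∀ c, Jacobian (Y c)) {B : AbelianVariety k} (φ : a.Alb ⟶ B)
    (hφ : φ ≠ 0) : ∃ c, albDesc a (inj c) (𝒥 c) ≫ AbelianVariety.Hom.baseChange ℂ φ ≠ 0 :=
  exists_albDesc_comp_baseChange_ne_zero a inj 𝒥
    (fun f g hfg => nablaLiftPiece_jointlyEpi (d := d) hX a inj hcol f g hfg) φ hφ

include d hX hcol in
/-- **Pull-back form, unconditionally** (Lemma 2.4 (1) currency: `(f^{P_c})^*` injective on `H¹`): a non-zero `φ : Alb_X → B`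
over `k` has a piece with `(f^{P_c} ≫ ψ_c ≫ φ_ℂ)^* ≠ 0` on `H¹(B(ℂ); ℚ)`. [cite: Liu2021, proof of Thm. 4.18 (FJcycle.tex l. 2248–2250) and Lemma 2.4 (1) (l. 1213, proof l. 1220–1228)] -/
theorem exists_pull_abelJacobi_albDesc_baseChange_ne_zero' (𝒥 : ∀ c, Jacobian (Y c)) (P : ∀ c, AlgPoints (Y c) ℂ)
    (hinj : ∀ c, Injective (BettiUniverse.pull ((𝒥 c).abelJacobi (P c)) 1)) {B : AbelianVariety k} (φ : a.Alb ⟶ B)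
    (hφ : φ ≠ 0) :
    ∃ c, BettiUniverse.pull
      ((𝒥 c).abelJacobi (P c) ≫ (albDesc a (inj c) (𝒥 c) ≫ AbelianVariety.Hom.baseChange ℂ φ).hom.hom.hom) 1 ≠ 0 :=
  exists_pull_abelJacobi_albDesc_baseChange_ne_zero a inj 𝒥
    (fun f g hfg => nablaLiftPiece_jointlyEpi (d := d) hX a inj hcol f g hfg) P hinj φ hφ

include d hX hcol in
/-- **Liu's `(α_X)_x|_{X_c}` spelling, unconditionally**: a non-zero `φ : Alb_X → B` over `k` has a piece with
`(albOnPiece a (inj c) (P c) ≫ φ_ℂ)^* ≠ 0` on `H¹(B(ℂ); ℚ)` — the `hfaith` leg of the pin's `P_injective` in the J2 currency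
(`phiStarQ K φ := (c ↦ (albOnPiece … ≫ φ_ℂ)^*)` is injective). [cite: Liu2021, proof of Thm. 4.18 (FJcycle.tex l. 2248–2250) and proof of Lemma 2.4 (1) (l. 1220–1228)] -/
theorem exists_pull_albOnPiece_baseChange_ne_zero' (𝒥 : ∀ c, Jacobian (Y c)) (P : ∀ c, AlgPoints (Y c) ℂ)
    (hinj : ∀ c, Injective (BettiUniverse.pull ((𝒥 c).abelJacobi (P c)) 1)) {B : AbelianVariety k} (φ : a.Alb ⟶ B)
    (hφ : φ ≠ 0) :
    ∃ c, BettiUniverse.pull (albOnPiece a (inj c) (P c) ≫ (AbelianVariety.Hom.baseChange ℂ φ).hom.hom.hom) 1 ≠ 0 :=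
  exists_pull_albOnPiece_baseChange_ne_zero a inj 𝒥
    (fun f g hfg => nablaLiftPiece_jointlyEpi (d := d) hX a inj hcol f g hfg) P hinj φ hφ

end Summit.HodgeConjecture.CorCM.D2Bridge

end
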